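import Summits.SmoothPoincare4.SmoothPoincare4.Theorems.SullivanDualTargetOfSympcap
import Summits.SmoothPoincare4.SmoothPoincare4.Theorems.SullivanDualTarget
import Summits.SmoothPoincare4.SmoothPoincare4.Theorems.SullivanDualGromovChartForm
import Literature.Geometry.Symplectic.GromovMcDuffTwistedSphereProofs
import Summits.SmoothPoincare4.SmoothPoincare4.Theorems.SullivanDualSpc4ReductionHomotopySphere
import Literature.Geometry.Symplectic.GromovR4StdModel

/-!
# SmoothPoincare4 / SullivanDual — the crux `Target` is exactly the summit

Crux `stmt-SmoothPoincare4-7823` (`Theses.SullivanDual.Target`), line `Sketch`, skeleton v5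
(continuation lead c2). The line is saturated: its one stub is route SymplecticCap's thesis
`SympcapThesisV2` (item 0518, verbatim), and `Target ↔ SympcapThesisV2` is landed
(`SullivanDual.target_iff_sympcapThesisV2`). This file closes the circle with the SUMMIT:

* `target_of_smoothPoincare4`, `sympcapThesisV2_of_smoothPoincare4`,
  `gromovChartForm_of_smoothPoincare4` — UNCONDITIONALLY, `SmoothPoincare4` implies the crux, the
  residual stub, and the route's named-fact debt `GromovChartForm` (item 11129);
* `smoothPoincare4_of_target` — conversely `Target → SmoothPoincare4` given `GromovChartForm`
  (the route's deciding theorem `closes` over the four LANDED supports);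
* hence `target_and_gromovChartForm_iff_smoothPoincare4 : Target ∧ GromovChartForm ↔ SmoothPoincare4`
  with NO hypothesis, `target_iff_smoothPoincare4 (hG : GromovChartForm) : Target ↔ SmoothPoincare4`,
  and the same two statements for the stub `SympcapThesisV2`;
* the negative side, unconditional: `not_smoothPoincare4_of_not_target` and
  `exists_isEmpty_diffeomorph_sphere_of_not_target` — if the crux fails, some homotopy 4-sphere
  is exotic; and, given `GromovChartForm`, an exotic homotopy 4-sphere refutes the crux
  (`not_target_of_isEmpty_diffeomorph_sphere`);
* pointwise: given `GromovChartForm`, the matrix of `Target` at ONE puncture `(Σ, p)` already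
  forces `Σ ≅ S⁴` (`nonempty_diffeomorph_sphere_of_targetAt`), so it holds at one puncture iff
  at every puncture (`targetAt_iff_nonempty_diffeomorph_sphere`);

So the residual stub of the line is the summit itself, modulo the single published-but-unformalised
input `GromovChartForm` ⇐ Gromov's recognition of `(ℝ⁴, ω₀)` relative at infinity
(McDuff–Salamon 2017, Rem. 4.5.2 (viii); item 11009).
-/

noncomputable section

-- the registered namespace `Summit.SmoothPoincare4.SmoothPoincare4.Theorems` repeats a component
set_option linter.dupNamespace false

open scoped Manifold ContDiff Topology
open Literature.Geometry.Kaehler Literature.Geometry.Symplectic Literature.Topology.FourManifolds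
open Summit.SmoothPoincare4.SmoothPoincare4.Theses.SullivanDual

namespace Summit.SmoothPoincare4.SmoothPoincare4.Theorems

namespace SullivanDual

/-! ### The summit on `HomotopySphere 4` -/

/-- **`SmoothPoincare4` unpacked on `HomotopySphere 4`**: under the problem statement every
homotopy 4-sphere (a compact oriented smooth 4-manifold homotopy equivalent to `S⁴`) is
diffeomorphic to the round `S⁴` — apply the statement to `S.carrier` with its own atlas and a
homotopy equivalence from `S.nonempty_homotopyEquiv`. [folklore] -/
theorem nonempty_diffeomorph_sphere_of_smoothPoincare4 (h : _root_.SmoothPoincare4)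
    (S : HomotopySphere 4) :
    Nonempty (S.carrier ≃ₘ⟮𝓡 4, 𝓡 4⟯ Metric.sphere (0 : EuclideanSpace ℝ (Fin 5)) 1) := by
  obtain ⟨e⟩ := S.nonempty_homotopyEquiv
  exact h S.carrier S.chartedSpace S.isManifold e

/-- **`SmoothPoincare4` ↔ every `HomotopySphere 4` is diffeomorphic to `S⁴`** (`→` unpacking,
`←` the landed packaging `spc4ReductionHomotopySphere_proof`: a smooth 4-manifold homotopy
equivalent to `S⁴` is compact and orientable). [folklore] -/
theorem smoothPoincare4_iff_forall_nonempty_diffeomorph_sphere :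
    _root_.SmoothPoincare4 ↔
      ∀ S : HomotopySphere 4,
        Nonempty (S.carrier ≃ₘ⟮𝓡 4, 𝓡 4⟯ Metric.sphere (0 : EuclideanSpace ℝ (Fin 5)) 1) :=
  ⟨nonempty_diffeomorph_sphere_of_smoothPoincare4, fun h => spc4ReductionHomotopySphere_proof h⟩

/-! ### The summit implies the crux, the stub and the debt — unconditionally -/

/-- **`SmoothPoincare4 → Target`** (unconditional): every homotopy 4-sphere is then diffeomorphic
to `S⁴`, and `Target` holds at every such sphere (`target_of_forall_nonempty_diffeomorph_sphere`:
`J = Φ^*J₀` tamed by the exact form `d(Φ^*λ₀)`, Palais' chart form `Φ`). [folklore] -/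
theorem target_of_smoothPoincare4 (h : _root_.SmoothPoincare4) : Target :=
  target_of_forall_nonempty_diffeomorph_sphere (nonempty_diffeomorph_sphere_of_smoothPoincare4 h)

/-- **`SmoothPoincare4 →` the residual stub `SympcapThesisV2`** (item 0518, verbatim;
unconditional): on `Σ ≅ S⁴` the form `Φ^*ω₀` for Palais' chart-form diffeomorphism
`Φ : Σ ∖ p ≃ₘ ℝ⁴` is symplectic and standard near `p`
(`exists_isSymplecticStandardNearPoint_of_nonempty_diffeomorph_sphere`). [cite: Gromov1985, §0.3.C] -/
theorem sympcapThesisV2_of_smoothPoincare4 (h : _root_.SmoothPoincare4) :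
    ∀ (S : Literature.Topology.FourManifolds.HomotopySphere 4) (p : S.carrier),
      ∃ (ε : ℝ) (sf : Literature.Geometry.Kaehler.MForm (𝓡 4)
        (Literature.Geometry.Symplectic.punctured p) ℝ 2),
        Literature.Geometry.Symplectic.IsSymplecticStandardNearPoint p ε sf :=
  fun S p => exists_isSymplecticStandardNearPoint_of_nonempty_diffeomorph_sphere
    (nonempty_diffeomorph_sphere_of_smoothPoincare4 h S) p

/-- **`SmoothPoincare4 → GromovChartForm`** (unconditional): the route's named-fact debt is
implied by the summit (`gromovChartForm_of_forall_nonempty_diffeomorph_sphere`: Palais' disc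
theorem straightens any diffeomorphism near the puncture; the symplectic form is not used).
[folklore] -/
theorem gromovChartForm_of_smoothPoincare4 (h : _root_.SmoothPoincare4) : GromovChartForm :=
  gromovChartForm_of_forall_nonempty_diffeomorph_sphere
    (nonempty_diffeomorph_sphere_of_smoothPoincare4 h)

/-! ### The crux implies the summit, given the debt -/

/-- **`Target → SmoothPoincare4` given `GromovChartForm`**: the route's deciding theorem `closes`
with its four other hypotheses discharged by the landed `ClosedModelExtension_proof` (7829),
`RelativeSullivanDuality_proof` (7827), `Literature.Geometry.Symplectic.sympcap_glue_chartStandardEnd`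
(item 0443, the body of `sympcapGlueChartStandardEnd_proof`) and `spc4ReductionHomotopySphere_proof`
(0374). [folklore] -/
theorem smoothPoincare4_of_target (hG : GromovChartForm) (hT : Target) : _root_.SmoothPoincare4 :=
  closes hT ClosedModelExtension_proof RelativeSullivanDuality_proof hG
    (fun S p Φ hΦ => sympcap_glue_chartStandardEnd S p Φ hΦ) spc4ReductionHomotopySphere_proof

/-- **The residual stub implies the summit, given `GromovChartForm`**: through
`target_of_sympcapThesisV2`. [folklore] -/
theorem smoothPoincare4_of_sympcapThesisV2 (hG : GromovChartForm)
    (h : ∀ (S : Literature.Topology.FourManifolds.HomotopySphere 4) (p : S.carrier),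
      ∃ (ε : ℝ) (sf : Literature.Geometry.Kaehler.MForm (𝓡 4)
        (Literature.Geometry.Symplectic.punctured p) ℝ 2),
        Literature.Geometry.Symplectic.IsSymplecticStandardNearPoint p ε sf) :
    _root_.SmoothPoincare4 :=
  smoothPoincare4_of_target hG (target_of_sympcapThesisV2 h)

/-! ### The crux is exactly the summit -/

/-- **`Target ∧ GromovChartForm ↔ SmoothPoincare4`, with NO hypothesis**: the crux of route
SullivanDual together with the route's single named-fact debt is exactly the summit. [folklore] -/
theorem target_and_gromovChartForm_iff_smoothPoincare4 :
    (Target ∧ GromovChartForm) ↔ _root_.SmoothPoincare4 :=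
  ⟨fun h => smoothPoincare4_of_target h.2 h.1,
    fun h => ⟨target_of_smoothPoincare4 h, gromovChartForm_of_smoothPoincare4 h⟩⟩

/-- **`Target ↔ SmoothPoincare4` given `GromovChartForm`.** [folklore] -/
theorem target_iff_smoothPoincare4 (hG : GromovChartForm) : Target ↔ _root_.SmoothPoincare4 :=
  ⟨smoothPoincare4_of_target hG, target_of_smoothPoincare4⟩

/-- **`SympcapThesisV2 ∧ GromovChartForm ↔ SmoothPoincare4`, with NO hypothesis**: the residual
stub of the line (item 0518) together with the debt is exactly the summit. [folklore] -/
theorem sympcapThesisV2_and_gromovChartForm_iff_smoothPoincare4 :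
    ((∀ (S : Literature.Topology.FourManifolds.HomotopySphere 4) (p : S.carrier),
      ∃ (ε : ℝ) (sf : Literature.Geometry.Kaehler.MForm (𝓡 4)
        (Literature.Geometry.Symplectic.punctured p) ℝ 2),
        Literature.Geometry.Symplectic.IsSymplecticStandardNearPoint p ε sf) ∧ GromovChartForm) ↔
      _root_.SmoothPoincare4 :=
  ⟨fun h => smoothPoincare4_of_sympcapThesisV2 h.2 h.1,
    fun h => ⟨sympcapThesisV2_of_smoothPoincare4 h, gromovChartForm_of_smoothPoincare4 h⟩⟩

/-- **`SympcapThesisV2 ↔ SmoothPoincare4` given `GromovChartForm`.** [folklore] -/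
theorem sympcapThesisV2_iff_smoothPoincare4 (hG : GromovChartForm) :
    (∀ (S : Literature.Topology.FourManifolds.HomotopySphere 4) (p : S.carrier),
      ∃ (ε : ℝ) (sf : Literature.Geometry.Kaehler.MForm (𝓡 4)
        (Literature.Geometry.Symplectic.punctured p) ℝ 2),
        Literature.Geometry.Symplectic.IsSymplecticStandardNearPoint p ε sf) ↔
      _root_.SmoothPoincare4 :=
  ⟨smoothPoincare4_of_sympcapThesisV2 hG, sympcapThesisV2_of_smoothPoincare4⟩

/-! ### The negative side -/

/-- **If the crux fails, the summit fails** (unconditional contrapositive of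
`target_of_smoothPoincare4`). [folklore] -/
theorem not_smoothPoincare4_of_not_target (h : ¬ Target) : ¬ _root_.SmoothPoincare4 :=
  mt target_of_smoothPoincare4 h

/-- **If the crux fails, some homotopy 4-sphere is exotic** (unconditional): `Target` holds as
soon as every homotopy 4-sphere is diffeomorphic to `S⁴`. [folklore] -/
theorem exists_isEmpty_diffeomorph_sphere_of_not_target (h : ¬ Target) :
    ∃ S : HomotopySphere 4,
      IsEmpty (S.carrier ≃ₘ⟮𝓡 4, 𝓡 4⟯ Metric.sphere (0 : EuclideanSpace ℝ (Fin 5)) 1) := by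
  by_contra hne
  exact h (target_of_forall_nonempty_diffeomorph_sphere fun S =>
    not_isEmpty_iff.1 fun hS => hne ⟨S, hS⟩)

/-- **An exotic homotopy 4-sphere refutes the crux, given `GromovChartForm`.** [folklore] -/
theorem not_target_of_isEmpty_diffeomorph_sphere (hG : GromovChartForm) (S : HomotopySphere 4)
    (hS : IsEmpty (S.carrier ≃ₘ⟮𝓡 4, 𝓡 4⟯ Metric.sphere (0 : EuclideanSpace ℝ (Fin 5)) 1)) :
    ¬ Target := fun hT =>
  hS.false (nonempty_diffeomorph_sphere_of_smoothPoincare4 (smoothPoincare4_of_target hG hT) S).some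

/-- **`¬ Target ↔` some homotopy 4-sphere is exotic, given `GromovChartForm`.** [folklore] -/
theorem not_target_iff_exists_isEmpty_diffeomorph_sphere (hG : GromovChartForm) :
    ¬ Target ↔ ∃ S : HomotopySphere 4,
      IsEmpty (S.carrier ≃ₘ⟮𝓡 4, 𝓡 4⟯ Metric.sphere (0 : EuclideanSpace ℝ (Fin 5)) 1) :=
  ⟨exists_isEmpty_diffeomorph_sphere_of_not_target,
    fun ⟨S, hS⟩ => not_target_of_isEmpty_diffeomorph_sphere hG S hS⟩

/-! ### One puncture decides the sphere -/

/-- **The matrix of `Target` at one puncture forces `Σ ≅ S⁴`, given `GromovChartForm`**: it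
yields a symplectic form standard near `p` (`isSymplecticStandardNearPoint_of_targetAt`, over
the landed supports 7829 + 7827), and the chart form turns that into a diffeomorphism with `S⁴`
(`gromovChartForm_iff_forall_nonempty_diffeomorph_sphere`). [folklore] -/
theorem nonempty_diffeomorph_sphere_of_targetAt (hG : GromovChartForm) (S : HomotopySphere 4)
    (p : S.carrier)
    (h : ∃ (J : ∀ x : punctured p, TangentSpace (𝓡 4) x →L[ℝ] TangentSpace (𝓡 4) x),
      (∀ (x : punctured p) (v : TangentSpace (𝓡 4) x), J x (J x v) = -v) ∧
      (∀ x₀ : punctured p, ContMDiffAt (𝓡 4)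
        𝓘(ℝ, EuclideanSpace ℝ (Fin 4) →L[ℝ] EuclideanSpace ℝ (Fin 4)) ∞
        (inTangentCoordinates (𝓡 4) (𝓡 4) (id : punctured p → punctured p) id
          (fun x => J x) x₀) x₀) ∧
      ∃ ε₁ : ℝ, 0 < ε₁ ∧ ∀ ε' : ℝ, 0 < ε' → ε' ≤ ε₁ → NoWitness p ε' J) :
    Nonempty (S.carrier ≃ₘ⟮𝓡 4, 𝓡 4⟯ Metric.sphere (0 : EuclideanSpace ℝ (Fin 5)) 1) := by
  obtain ⟨ε, sf, hsf⟩ := isSymplecticStandardNearPoint_of_targetAt S p h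
  exact gromovChartForm_iff_forall_nonempty_diffeomorph_sphere.1 hG S p ε sf hsf

/-- **`Σ ≅ S⁴` gives the matrix of `Target` at every puncture** (unconditional): the symplectic
form `Φ^*ω₀` standard near `p` tames its compatible `J`, which then has no taming witness at any
small radius (`targetAt_of_isSymplecticStandardNearPoint`). [folklore] -/
theorem targetAt_of_nonempty_diffeomorph_sphere (S : HomotopySphere 4)
    (hS : Nonempty (S.carrier ≃ₘ⟮𝓡 4, 𝓡 4⟯ Metric.sphere (0 : EuclideanSpace ℝ (Fin 5)) 1))
    (p : S.carrier) :
    ∃ (J : ∀ x : punctured p, TangentSpace (𝓡 4) x →L[ℝ] TangentSpace (𝓡 4) x),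
      (∀ (x : punctured p) (v : TangentSpace (𝓡 4) x), J x (J x v) = -v) ∧
      (∀ x₀ : punctured p, ContMDiffAt (𝓡 4)
        𝓘(ℝ, EuclideanSpace ℝ (Fin 4) →L[ℝ] EuclideanSpace ℝ (Fin 4)) ∞
        (inTangentCoordinates (𝓡 4) (𝓡 4) (id : punctured p → punctured p) id
          (fun x => J x) x₀) x₀) ∧
      ∃ ε₁ : ℝ, 0 < ε₁ ∧ ∀ ε' : ℝ, 0 < ε' → ε' ≤ ε₁ → NoWitness p ε' J := by
  obtain ⟨ε, sf, hsf⟩ := exists_isSymplecticStandardNearPoint_of_nonempty_diffeomorph_sphere hS p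
  exact targetAt_of_isSymplecticStandardNearPoint S p hsf

/-- **One puncture decides the sphere**: given `GromovChartForm`, the matrix of `Target` at
`(Σ, p)` holds iff `Σ ≅ S⁴`; in particular it is independent of the puncture `p` and of the
choice of `J`. [folklore] -/
theorem targetAt_iff_nonempty_diffeomorph_sphere (hG : GromovChartForm) (S : HomotopySphere 4)
    (p : S.carrier) :
    (∃ (J : ∀ x : punctured p, TangentSpace (𝓡 4) x →L[ℝ] TangentSpace (𝓡 4) x),
      (∀ (x : punctured p) (v : TangentSpace (𝓡 4) x), J x (J x v) = -v) ∧
      (∀ x₀ : punctured p, ContMDiffAt (𝓡 4)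
        𝓘(ℝ, EuclideanSpace ℝ (Fin 4) →L[ℝ] EuclideanSpace ℝ (Fin 4)) ∞
        (inTangentCoordinates (𝓡 4) (𝓡 4) (id : punctured p → punctured p) id
          (fun x => J x) x₀) x₀) ∧
      ∃ ε₁ : ℝ, 0 < ε₁ ∧ ∀ ε' : ℝ, 0 < ε' → ε' ≤ ε₁ → NoWitness p ε' J) ↔
    Nonempty (S.carrier ≃ₘ⟮𝓡 4, 𝓡 4⟯ Metric.sphere (0 : EuclideanSpace ℝ (Fin 5)) 1) :=
  ⟨nonempty_diffeomorph_sphere_of_targetAt hG S p,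
    fun hS => targetAt_of_nonempty_diffeomorph_sphere S hS p⟩

end SullivanDual

end Summit.SmoothPoincare4.SmoothPoincare4.Theorems

end
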